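import Summits.SmoothPoincare4.SmoothPoincare4.Theorems.ConvexBisectionAcyclicBisectionExistsHurwitzMoveDichotomy
import Summits.SmoothPoincare4.SmoothPoincare4.Theorems.ConvexBisectionAcyclicBisectionExistsHurwitzMoveClasses
import Literature.Geometry.Symplectic.LefschetzSteinOpenBookBaseTransport
import HarnessLib

/-!
# N1-move: the CONTRACT `node_N1_move ⇐ (c₁) ∧ (c₂) ∧ (d) ∧ (e)` — one handle dragged through pages
(wave 7, brick of stub `stub_M2geo` = node N1 of NF4 ▸ `node_N1_move`, line `modp-braid-orbits`, crux
`ConvexBisection.AcyclicBisectionExists`, item stmt-SmoothPoincare4-10508; worker H7, lead c5;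
registered sub-goal `helper_sameSign_of_pushoff`)

`node_N1_move` (G4, `N1_HurwitzMove_Design.lean` §2 = the hypothesis `hmove` of the landed
`swap_of_move`, `…HurwitzMoveSwap.lean`) is the ONE ∀-statement left in N1: one handle `k₀` of a
generalised Lefschetz link on fibred data `(X₀, bX, Ψ, X, G₀, h, D)` is dragged by a signed angle `φ`
through a sector of pages containing at most one other handle `k₁`.  This file lands the ASSEMBLY
**`node_N1_move_of_pieces (HC1) (HC2) (HD) (HE) : <node_N1_move verbatim>`** from four pieces
(design v2 `work/design/N1_Move_Design.lean`, H7):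

* (c₁) `HC1` FREE SLICE MOVE, (c₂) `HC2` ACROSS-ONE-BELT SLICE MOVE — the geometric re-digging of the
  handle (Gompf–Stipsicz 1999 §8.2 read through Kas' handlebody; G4's findings (F1)–(F6)).  OUTPUT: a new
  datum `(X', h', D', G)` whose `k₀`-th attaching circle is `R₃(τ₃) ∘ L'`, where `L = R₁(τ₁) ∘ K` is a
  push-off of the old circle `K` into the seam page of direction `d k₀ e^{iε}` and `L'` is the TRANSPORT OF
  `L` THROUGH `Ψ` by the rigid page rotation `R` (`w ∘ R_t = e^{it} w`, `helper_exists_rigidRotation`) by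
  the angle `φ − ε`, read back on the base through the seam; circles and framings of the other handles and
  the page twisting of `k₀` unchanged; and the SEAM/BELT DICHOTOMY of the new presentation through `G`.
  Thin tubes (piece (a), `helper_exists_thinData`, LANDED) are made inside (c₁)/(c₂).
* (d) `HD` ACROSS-BELT MONODROMY ON SHADOWS (H4's deep-belt model `helper_N1_beltMonodromy` bridged by
  N1a, the open half of piece (e)): crossing exactly one belt direction `d k₁`, the seam transport
  through `Ψ` acts on shadows by `transvection (stdSymp ℤ g) (v k₁, s k₁)` (counter-clockwise) resp.
  `(v k₁, ¬ s k₁)` (clockwise) — the audit point (F5).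
* (e) `HE` FREE SEAM TRANSPORT PRESERVES SHADOWS — LANDED (`helper_shadow_seamTransport_free`, p170593).

§2 lands piece (c₃) `transport_dichotomy` (the conjugate transport along a ray-preserving base
diffeomorphism satisfies the dichotomy — the normalisation step of (c₁)/(c₂)).  Assembly (§3): rigid `R`; `cross = none`: (c₁), shadow of the new circle
`= shadow L' = shadow L = v k₀` (isotopy invariance, (e)); `cross = some k₁`: (c₂), `= T (shadow L)` by
(d) on the sub-arc `[ε, φ]` (`subarc`: it contains `d k₁` strictly and no other direction; same sign as
`φ`, `sameSign_of_pushoff`); pages, twistings by the outputs; seam and belt clauses by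
`clauses_of_dichotomy`.  Everything here is proved; the pieces enter as hypotheses; no `sorry`.
Reference: R. E. Gompf, A. I. Stipsicz, *4-Manifolds and Kirby Calculus* (1999), §8.2 [GompfStipsicz1999].
-/

noncomputable section

set_option linter.dupNamespace false

open scoped Manifold ContDiff Topology Real
open Set Function

namespace Summit.SmoothPoincare4.SmoothPoincare4.Theorems.AcyclicBisectionExists.ModpBraidOrbits

open Literature.GroupTheory.CombinatorialGroupTheory.SignedHurwitz
open Literature.Topology.FourManifolds Literature.Topology.FourManifolds.LefschetzBase
open Literature.Topology.FourManifolds.HandleAttachingMap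
open HurwitzMoveContract

/-! ## §1 The sign of the remaining angle after the push-off -/

/-- **Sub-goal `helper_sameSign_of_pushoff`** (fully qualified): if `0 < ε/φ < 1` then `φ − ε` is
non-zero, has the sign of `φ`, and `|φ − ε| < |φ|`. [folklore] -/
theorem helper_sameSign_of_pushoff : ∀ (φ ε : ℝ), 0 < ε / φ → ε / φ < 1 → (0 < φ - ε ↔ 0 < φ) ∧ φ - ε ≠ 0 ∧ |φ - ε| < |φ| := by
  intro φ ε h0 h1
  have hφ : φ ≠ 0 := by rintro rfl; simp at h0
  rcases lt_or_gt_of_ne hφ with hneg | hpos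
  · have hε : φ < ε := by rwa [div_lt_one_of_neg hneg] at h1
    have hε0 : ε < 0 := by
      rcases lt_trichotomy ε 0 with hl | rfl | hg
      · exact hl
      · simp at h0
      · exact absurd h0 (not_lt.2 (div_nonpos_of_nonneg_of_nonpos hg.le hneg.le))
    refine ⟨⟨fun h => absurd h (by linarith), fun h => absurd h (by linarith)⟩, by linarith, ?_⟩
    rw [abs_of_neg (by linarith), abs_of_neg hneg]; linarith
  · have hε : ε < φ := by rwa [div_lt_one hpos] at h1
    have hε0 : 0 < ε := (div_pos_iff_of_pos_right hpos).1 h0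
    refine ⟨⟨fun _ => hpos, fun _ => by linarith⟩, by linarith, ?_⟩
    rw [abs_of_pos (by linarith), abs_of_pos hpos]; linarith

/-! ## §2 Piece (c₃): the dichotomy of a conjugate transport along a ray-preserving base diffeomorphism -/

section Transport

variable {g n : ℕ} {h : Fin n → HandleAttachingMap 3 2 (Base g)}
  {X : Type} [TopologicalSpace X] [ChartedSpace (EuclideanHalfSpace 4) X]

/-- **Piece (c₃) — the seam/belt dichotomy of a conjugate transport** (the normalisation step of the
slice constructions (c₁)/(c₂), and G4's "model replacement" in data form): for a diffeomorphism `J` of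
`Base g` preserving every `w`-ray (`w (J x) ∈ ℝ_{>0} w x`), the tree's transported datum `D.transport J` of
the SAME `X` along `(h k).transport J` satisfies the dichotomy clauses of the contract with `G = refl` and
unchanged directions: every new seam point is the old seam point `J⁻¹ a'` on the same ray, every new deep
belt point is an old deep belt point of the same handle.  (By G4's finding (F1) this is all a conjugate-type
transport can do: it never moves a handle to another page.) [cite: Kosinski1993, VI §6 and VIII proof of (1.2)] -/
theorem transport_dichotomy (D : MultiAttachmentData h (𝓡∂ 4) X) (J : Base g ≃ₘ⟮𝓡∂ 4, 𝓡∂ 4⟯ Base g)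
    (hJ : ∀ x : Base g, ∃ r : ℝ, 0 < r ∧ w g (J x).1 = (r : ℂ) * w g x.1) (d : Fin n → ℂ) :
    (∀ a' : ↥(coresComplement fun k => (h k).transport J),
      (Diffeomorph.refl (𝓡∂ 4) X ∞).symm ((D.transport J).jA a') ∈ (𝓡∂ 4).boundary X →
      (∃ a : ↥(coresComplement h), (Diffeomorph.refl (𝓡∂ 4) X ∞).symm ((D.transport J).jA a') = D.jA a ∧
        ∃ c : ℝ, 0 < c ∧ w g (a' : Base g).1 = (c : ℂ) * w g (a : Base g).1) ∨
      (∃ (k : Fin n) (b : ↥(beltPiece 3 2)),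
        (Diffeomorph.refl (𝓡∂ 4) X ∞).symm ((D.transport J).jA a') = D.jB k b ∧
        (Diffeomorph.refl (𝓡∂ 4) X ∞).symm ((D.transport J).jA a') ∉ range D.jA ∧
        ∃ c : ℝ, 0 < c ∧ w g (a' : Base g).1 = (c : ℂ) * d k)) ∧
    (∀ (k' : Fin n) (b' : ↥(beltPiece 3 2)), (D.transport J).jB k' b' ∉ range (D.transport J).jA →
      (Diffeomorph.refl (𝓡∂ 4) X ∞).symm ((D.transport J).jB k' b') ∈ (𝓡∂ 4).boundary X →
      (∃ a : ↥(coresComplement h), (Diffeomorph.refl (𝓡∂ 4) X ∞).symm ((D.transport J).jB k' b') = D.jA a ∧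
        ∃ c : ℝ, 0 < c ∧ w g (a : Base g).1 = (c : ℂ) * d k') ∨
      (∃ (k : Fin n) (b : ↥(beltPiece 3 2)),
        (Diffeomorph.refl (𝓡∂ 4) X ∞).symm ((D.transport J).jB k' b') = D.jB k b ∧
        (Diffeomorph.refl (𝓡∂ 4) X ∞).symm ((D.transport J).jB k' b') ∉ range D.jA ∧ d k = d k')) := by
  have hr : range (D.transport J).jA = range D.jA :=
    (coresComplementCongr h J).surjective.range_comp D.jA
  constructor
  · intro a' _
    left
    refine ⟨coresComplementCongr h J a', rfl, ?_⟩
    obtain ⟨r, hr0, hw⟩ := hJ (J.symm (a' : Base g))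
    rw [Diffeomorph.apply_symm_apply] at hw
    exact ⟨r, hr0, hw⟩
  · intro k' b' hdeep _
    right
    refine ⟨k', b', rfl, ?_, rfl⟩
    show D.jB k' b' ∉ range D.jA
    rw [← hr]; exact hdeep

end Transport

/-! ## §3 The assembly -/

set_option maxHeartbeats 800000 in
-- four ∀-texts of 40–60 binders each as hypotheses; the two `obtain`s destructure 27 components
/-- **`node_N1_move` from the pieces (c₁), (c₂), (d), (e)** — see the module docstring.  The conclusion
is the text of `node_N1_move` (= hypothesis `hmove` of `swap_of_move`) VERBATIM, so that with the tree
`stub_M2geo := m2geo_of_transfer (transfer_of_swap' (swap_of_move (node_N1_move_of_pieces HC1 HC2 HD HE)))`.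
[cite: GompfStipsicz1999, §8.2] -/
theorem node_N1_move_of_pieces
    (HC1 : ∀ (g n : ℕ) (X₀ : Type) [TopologicalSpace X₀] [T2Space X₀] [SecondCountableTopology X₀] [CompactSpace X₀] [ChartedSpace (EuclideanHalfSpace 4) X₀] [IsManifold (𝓡∂ 4) ∞ X₀] (bX : BoundaryData (𝓡∂ 4) X₀ (𝓡 3)) (Ψ : bX.carrier ≃ₘ⟮𝓡 3, 𝓡 3⟯ (bBase g).carrier) (X : Type) [TopologicalSpace X] [T2Space X] [SecondCountableTopology X] [CompactSpace X] [ChartedSpace (EuclideanHalfSpace 4) X] [IsManifold (𝓡∂ 4) ∞ X] (G₀ : X₀ ≃ₘ⟮𝓡∂ 4, 𝓡∂ 4⟯ X) (h : Fin n → HandleAttachingMap 3 2 (Base g)) (D : MultiAttachmentData h (𝓡∂ 4) X) (d : Fin n → ℂ), (∀ k, ‖d k‖ = 1) → (∀ k θ, (h k).attachingCircle θ ∈ page g (d k)) → (∀ (y : bX.carrier) (a : ↥(coresComplement h)), G₀ (bX.incl y) = D.jA a → ∃ c : ℝ, 0 < c ∧ w g ((bBase g).incl (Ψ y)).1 = (c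 : ℂ) * w g (a : Base g).1) → (∀ (y : bX.carrier) (k : Fin n) (b : ↥(beltPiece 3 2)), G₀ (bX.incl y) = D.jB k b → G₀ (bX.incl y) ∉ range D.jA → ∃ c : ℝ, 0 < c ∧ w g ((bBase g).incl (Ψ y)).1 = (c : ℂ) * d k) → ∀ (k₀ : Fin n) (ψ : ℝ) (R : AmbientIsotopy (𝓡∂ 4) (Base g)), ψ ≠ 0 → |ψ| < 2 * π → (∀ (t : ℝ) (x : Base g), rho g (R.toFun t x).1 = rho g x.1) → (∀ (t : ℝ) (x : Base g), w g (R.toFun t x).1 = Complex.exp ((t : ℂ) * Complex.I) * w g x.1) → (∀ (t : ℝ) (x : Base g), ‖cx (R.toFun t x).1‖ ^ 2 < 4 ↔ ‖cx x.1‖ ^ 2 < 4) → (∀ (t t' : ℝ) (x : Base g), R.toFun t (R.toFun t' x) = R.toFun (t + t') x) → (∀ k, k ≠ k₀ → ∀ t ∈ Set.Icc (0 : ℝ) 1, d k ≠ d k₀ * Complex.exp (((t * ψ : ℝ) : ℂ) * Complex.I)) → ∃ (X' : Type) (_ : TopologicalSpace X') (_ : T2Space X') (_ : SecondCountableTopology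 X') (_ : CompactSpace X') (_ : ChartedSpace (EuclideanHalfSpace 4) X') (_ : IsManifold (𝓡∂ 4) ∞ X') (h' : Fin n → HandleAttachingMap 3 2 (Base g)) (D' : MultiAttachmentData h' (𝓡∂ 4) X') (G : X ≃ₘ⟮𝓡∂ 4, 𝓡∂ 4⟯ X') (R₁ R₃ : AmbientIsotopy (𝓡∂ 4) (Base g)) (τ₁ τ₃ ε : ℝ) (L L' : Metric.sphere (0 : EuclideanSpace ℝ (Fin 2)) 1 → Base g) (y y' : Metric.sphere (0 : EuclideanSpace ℝ (Fin 2)) 1 → bX.carrier) (a a' : Metric.sphere (0 : EuclideanSpace ℝ (Fin 2)) 1 → ↥(coresComplement h)), (0 < ε / ψ ∧ ε / ψ < 1) ∧ Continuous L ∧ Continuous L' ∧ (∀ θ, L θ = R₁.toFun τ₁ ((h k₀).attachingCircle θ)) ∧ (∀ θ, L θ ∈ page g (d k₀ * Complex.exp ((ε : ℂ) * Complex.I))) ∧ (∀ θ, G₀ (bX.incl (y θ)) = D.jA (a θ)) ∧ (∀ θ, ((a θ : ↥(coresComplement h)) : Base g) = L θ) ∧ (∀ θ, (bBase g).incl (Ψ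 (y' θ)) = R.toFun (ψ - ε) ((bBase g).incl (Ψ (y θ)))) ∧ (∀ θ, G₀ (bX.incl (y' θ)) = D.jA (a' θ)) ∧ (∀ θ, ((a' θ : ↥(coresComplement h)) : Base g) = L' θ) ∧ (∀ θ, (h' k₀).attachingCircle θ = R₃.toFun τ₃ (L' θ)) ∧ (∀ θ, (h' k₀).attachingCircle θ ∈ page g (d k₀ * Complex.exp ((ψ : ℂ) * Complex.I))) ∧ (∀ k, k ≠ k₀ → (h' k).attachingCircle = (h k).attachingCircle ∧ (h' k).attachingFraming = (h k).attachingFraming) ∧ pageTwisting g (h' k₀).attachingCircle (h' k₀).attachingFraming = pageTwisting g (h k₀).attachingCircle (h k₀).attachingFraming ∧ (∀ a' : ↥(coresComplement h'), G.symm (D'.jA a') ∈ (𝓡∂ 4).boundary X → (∃ a : ↥(coresComplement h), G.symm (D'.jA a') = D.jA a ∧ ∃ c : ℝ, 0 < c ∧ w g (a' : Base g).1 = (c : ℂ) * w g (a : Base g).1) ∨ (∃ (k : Fin n) (b : ↥(beltPiece 3 2)), G.symm (D'.jA a') = D.jB k b ∧ G.symm (D'.jA a') ∉ range D.jA ∧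 ∃ c : ℝ, 0 < c ∧ w g (a' : Base g).1 = (c : ℂ) * d k)) ∧ (∀ (k' : Fin n) (b' : ↥(beltPiece 3 2)), D'.jB k' b' ∉ range D'.jA → G.symm (D'.jB k' b') ∈ (𝓡∂ 4).boundary X → (∃ a : ↥(coresComplement h), G.symm (D'.jB k' b') = D.jA a ∧ ∃ c : ℝ, 0 < c ∧ w g (a : Base g).1 = (c : ℂ) * Function.update d k₀ (d k₀ * Complex.exp ((ψ : ℂ) * Complex.I)) k') ∨ (∃ (k : Fin n) (b : ↥(beltPiece 3 2)), G.symm (D'.jB k' b') = D.jB k b ∧ G.symm (D'.jB k' b') ∉ range D.jA ∧ d k = Function.update d k₀ (d k₀ * Complex.exp ((ψ : ℂ) * Complex.I)) k')))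
    (HC2 : ∀ (g n : ℕ) (X₀ : Type) [TopologicalSpace X₀] [T2Space X₀] [SecondCountableTopology X₀] [CompactSpace X₀] [ChartedSpace (EuclideanHalfSpace 4) X₀] [IsManifold (𝓡∂ 4) ∞ X₀] (bX : BoundaryData (𝓡∂ 4) X₀ (𝓡 3)) (Ψ : bX.carrier ≃ₘ⟮𝓡 3, 𝓡 3⟯ (bBase g).carrier) (X : Type) [TopologicalSpace X] [T2Space X] [SecondCountableTopology X] [CompactSpace X] [ChartedSpace (EuclideanHalfSpace 4) X] [IsManifold (𝓡∂ 4) ∞ X] (G₀ : X₀ ≃ₘ⟮𝓡∂ 4, 𝓡∂ 4⟯ X) (h : Fin n → HandleAttachingMap 3 2 (Base g)) (D : MultiAttachmentData h (𝓡∂ 4) X) (d : Fin n → ℂ), (∀ k, ‖d k‖ = 1) → (∀ k θ, (h k).attachingCircle θ ∈ page g (d k)) → (∀ (y : bX.carrier) (a : ↥(coresComplement h)), G₀ (bX.incl y) = D.jA a → ∃ c : ℝ, 0 < c ∧ w g ((bBase g).incl (Ψ y)).1 = (c : ℂ) * w g (a : Base g).1) → (∀ (y : bX.carrier) (k : Fin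 n) (b : ↥(beltPiece 3 2)), G₀ (bX.incl y) = D.jB k b → G₀ (bX.incl y) ∉ range D.jA → ∃ c : ℝ, 0 < c ∧ w g ((bBase g).incl (Ψ y)).1 = (c : ℂ) * d k) → ∀ (k₀ k₁ : Fin n) (ψ : ℝ) (R : AmbientIsotopy (𝓡∂ 4) (Base g)), k₁ ≠ k₀ → ψ ≠ 0 → |ψ| < 2 * π → (∀ (t : ℝ) (x : Base g), rho g (R.toFun t x).1 = rho g x.1) → (∀ (t : ℝ) (x : Base g), w g (R.toFun t x).1 = Complex.exp ((t : ℂ) * Complex.I) * w g x.1) → (∀ (t : ℝ) (x : Base g), ‖cx (R.toFun t x).1‖ ^ 2 < 4 ↔ ‖cx x.1‖ ^ 2 < 4) → (∀ (t t' : ℝ) (x : Base g), R.toFun t (R.toFun t' x) = R.toFun (t + t') x) → (∃ t ∈ Set.Ioo (0 : ℝ) 1, d k₁ = d k₀ * Complex.exp (((t * ψ : ℝ) : ℂ) * Complex.I)) → (∀ k, k ≠ k₀ → k ≠ k₁ → ∀ t ∈ Set.Icc (0 : ℝ) 1, d k ≠ d k₀ * Complex.exp (((t * ψ : ℝ) :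 ℂ) * Complex.I)) → ∃ (X' : Type) (_ : TopologicalSpace X') (_ : T2Space X') (_ : SecondCountableTopology X') (_ : CompactSpace X') (_ : ChartedSpace (EuclideanHalfSpace 4) X') (_ : IsManifold (𝓡∂ 4) ∞ X') (h' : Fin n → HandleAttachingMap 3 2 (Base g)) (D' : MultiAttachmentData h' (𝓡∂ 4) X') (G : X ≃ₘ⟮𝓡∂ 4, 𝓡∂ 4⟯ X') (R₁ R₃ : AmbientIsotopy (𝓡∂ 4) (Base g)) (τ₁ τ₃ ε : ℝ) (L L' : Metric.sphere (0 : EuclideanSpace ℝ (Fin 2)) 1 → Base g) (y y' : Metric.sphere (0 : EuclideanSpace ℝ (Fin 2)) 1 → bX.carrier) (a a' : Metric.sphere (0 : EuclideanSpace ℝ (Fin 2)) 1 → ↥(coresComplement h)), (0 < ε / ψ ∧ ε / ψ < 1) ∧ (∃ t ∈ Set.Ioo (0 : ℝ) 1, d k₁ = d k₀ * Complex.exp ((ε : ℂ) * Complex.I) * Complex.exp (((t * (ψ - ε) : ℝ) : ℂ) * Complex.I)) ∧ Continuous L ∧ Continuous L' ∧ (∀ θ, L θ = R₁.toFun τ₁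 ((h k₀).attachingCircle θ)) ∧ (∀ θ, L θ ∈ page g (d k₀ * Complex.exp ((ε : ℂ) * Complex.I))) ∧ (∀ θ, G₀ (bX.incl (y θ)) = D.jA (a θ)) ∧ (∀ θ, ((a θ : ↥(coresComplement h)) : Base g) = L θ) ∧ (∀ θ, (bBase g).incl (Ψ (y' θ)) = R.toFun (ψ - ε) ((bBase g).incl (Ψ (y θ)))) ∧ (∀ θ, G₀ (bX.incl (y' θ)) = D.jA (a' θ)) ∧ (∀ θ, ((a' θ : ↥(coresComplement h)) : Base g) = L' θ) ∧ (∀ θ, (h' k₀).attachingCircle θ = R₃.toFun τ₃ (L' θ)) ∧ (∀ θ, (h' k₀).attachingCircle θ ∈ page g (d k₀ * Complex.exp ((ψ : ℂ) * Complex.I))) ∧ (∀ k, k ≠ k₀ → (h' k).attachingCircle = (h k).attachingCircle ∧ (h' k).attachingFraming = (h k).attachingFraming) ∧ pageTwisting g (h' k₀).attachingCircle (h' k₀).attachingFraming = pageTwisting g (h k₀).attachingCircle (h k₀).attachingFraming ∧ (∀ a' : ↥(coresComplement h'), G.symm (D'.jA a') ∈ (𝓡∂ 4).boundary X → (∃ a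 : ↥(coresComplement h), G.symm (D'.jA a') = D.jA a ∧ ∃ c : ℝ, 0 < c ∧ w g (a' : Base g).1 = (c : ℂ) * w g (a : Base g).1) ∨ (∃ (k : Fin n) (b : ↥(beltPiece 3 2)), G.symm (D'.jA a') = D.jB k b ∧ G.symm (D'.jA a') ∉ range D.jA ∧ ∃ c : ℝ, 0 < c ∧ w g (a' : Base g).1 = (c : ℂ) * d k)) ∧ (∀ (k' : Fin n) (b' : ↥(beltPiece 3 2)), D'.jB k' b' ∉ range D'.jA → G.symm (D'.jB k' b') ∈ (𝓡∂ 4).boundary X → (∃ a : ↥(coresComplement h), G.symm (D'.jB k' b') = D.jA a ∧ ∃ c : ℝ, 0 < c ∧ w g (a : Base g).1 = (c : ℂ) * Function.update d k₀ (d k₀ * Complex.exp ((ψ : ℂ) * Complex.I)) k') ∨ (∃ (k : Fin n) (b : ↥(beltPiece 3 2)), G.symm (D'.jB k' b') = D.jB k b ∧ G.symm (D'.jB k' b') ∉ range D.jA ∧ d k = Function.update d k₀ (d k₀ * Complex.exp ((ψ : ℂ) * Complex.I)) k')))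
    (HD : ∀ (g n : ℕ) (X₀ : Type) [TopologicalSpace X₀] [T2Space X₀] [SecondCountableTopology X₀] [CompactSpace X₀] [ChartedSpace (EuclideanHalfSpace 4) X₀] [IsManifold (𝓡∂ 4) ∞ X₀] (bX : BoundaryData (𝓡∂ 4) X₀ (𝓡 3)) (Ψ : bX.carrier ≃ₘ⟮𝓡 3, 𝓡 3⟯ (bBase g).carrier) (X : Type) [TopologicalSpace X] [T2Space X] [SecondCountableTopology X] [CompactSpace X] [ChartedSpace (EuclideanHalfSpace 4) X] [IsManifold (𝓡∂ 4) ∞ X] (G₀ : X₀ ≃ₘ⟮𝓡∂ 4, 𝓡∂ 4⟯ X) (h : Fin n → HandleAttachingMap 3 2 (Base g)) (D : MultiAttachmentData h (𝓡∂ 4) X) (d : Fin n → ℂ) (v : Fin n → (Fin g ⊕ Fin g → ℤ)) (s : Fin n → Bool), (∀ k, ‖d k‖ = 1) → (∀ k θ, (h k).attachingCircle θ ∈ page g (d k)) → (∀ k, shadow g (h k).attachingCircle (h k).continuous_attachingCircle = v k) → (∀ k, pageTwisting g (h k).attachingCircle (h k).attachingFraming = if s k then -1 else 1) → (∀ (y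 : bX.carrier) (a : ↥(coresComplement h)), G₀ (bX.incl y) = D.jA a → ∃ c : ℝ, 0 < c ∧ w g ((bBase g).incl (Ψ y)).1 = (c : ℂ) * w g (a : Base g).1) → (∀ (y : bX.carrier) (k : Fin n) (b : ↥(beltPiece 3 2)), G₀ (bX.incl y) = D.jB k b → G₀ (bX.incl y) ∉ range D.jA → ∃ c : ℝ, 0 < c ∧ w g ((bBase g).incl (Ψ y)).1 = (c : ℂ) * d k) → ∀ (k₁ : Fin n) (R : AmbientIsotopy (𝓡∂ 4) (Base g)), (∀ (t : ℝ) (x : Base g), rho g (R.toFun t x).1 = rho g x.1) → (∀ (t : ℝ) (x : Base g), w g (R.toFun t x).1 = Complex.exp ((t : ℂ) * Complex.I) * w g x.1) → (∀ (t : ℝ) (x : Base g), ‖cx (R.toFun t x).1‖ ^ 2 < 4 ↔ ‖cx x.1‖ ^ 2 < 4) → (∀ (t t' : ℝ) (x : Base g), R.toFun t (R.toFun t' x) = R.toFun (t + t') x) → ∀ (c₀ : ℂ) (T : ℝ), ‖c₀‖ = 1 → T ≠ 0 → |T| < 2 * π → (∃ t ∈ Set.Ioo (0 : ℝ) 1,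 d k₁ = c₀ * Complex.exp (((t * T : ℝ) : ℂ) * Complex.I)) → (∀ k, k ≠ k₁ → ∀ t ∈ Set.Icc (0 : ℝ) 1, d k ≠ c₀ * Complex.exp (((t * T : ℝ) : ℂ) * Complex.I)) → ∀ (L L' : Metric.sphere (0 : EuclideanSpace ℝ (Fin 2)) 1 → Base g) (hL : Continuous L) (hL' : Continuous L') (y y' : Metric.sphere (0 : EuclideanSpace ℝ (Fin 2)) 1 → bX.carrier) (a a' : Metric.sphere (0 : EuclideanSpace ℝ (Fin 2)) 1 → ↥(coresComplement h)), (∀ θ, L θ ∈ page g c₀) → (∀ θ, G₀ (bX.incl (y θ)) = D.jA (a θ)) → (∀ θ, ((a θ : ↥(coresComplement h)) : Base g) = L θ) → (∀ θ, (bBase g).incl (Ψ (y' θ)) = R.toFun T ((bBase g).incl (Ψ (y θ)))) → (∀ θ, G₀ (bX.incl (y' θ)) = D.jA (a' θ)) → (∀ θ, ((a' θ : ↥(coresComplement h)) : Base g) = L' θ) → shadow g L' hL' = transvection (stdSymp ℤ g) (v k₁, if 0 < T then s k₁ else !s k₁) (shadow g L hL))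
    (HE : ∀ (g n : ℕ) (X₀ : Type) [TopologicalSpace X₀] [ChartedSpace (EuclideanHalfSpace 4) X₀] (bX : BoundaryData (𝓡∂ 4) X₀ (𝓡 3)) (Ψ : bX.carrier ≃ₘ⟮𝓡 3, 𝓡 3⟯ (bBase g).carrier) (X : Type) [TopologicalSpace X] [ChartedSpace (EuclideanHalfSpace 4) X] (G₀ : X₀ ≃ₘ⟮𝓡∂ 4, 𝓡∂ 4⟯ X) (h : Fin n → HandleAttachingMap 3 2 (Base g)) (D : MultiAttachmentData h (𝓡∂ 4) X) (d : Fin n → ℂ), (∀ k, ‖d k‖ = 1) → (∀ (y : bX.carrier) (a : ↥(coresComplement h)), G₀ (bX.incl y) = D.jA a → ∃ c : ℝ, 0 < c ∧ w g ((bBase g).incl (Ψ y)).1 = (c : ℂ) * w g (a : Base g).1) → (∀ (y : bX.carrier) (k : Fin n) (b : ↥(beltPiece 3 2)), G₀ (bX.incl y) = D.jB k b → G₀ (bX.incl y) ∉ Set.range D.jA → ∃ c : ℝ, 0 < c ∧ w g ((bBase g).incl (Ψ y)).1 = (c : ℂ) * d k) → ∀ (R : AmbientIsotopy (𝓡∂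 4) (Base g)), (∀ (t : ℝ) (x : Base g), rho g (R.toFun t x).1 = rho g x.1) → (∀ (t : ℝ) (x : Base g), w g (R.toFun t x).1 = Complex.exp ((t : ℂ) * Complex.I) * w g x.1) → ∀ (c₀ : ℂ) (T : ℝ), ‖c₀‖ = 1 → (∀ (k : Fin n), ∀ t ∈ Set.Icc (0 : ℝ) 1, d k ≠ c₀ * Complex.exp (((t * T : ℝ) : ℂ) * Complex.I)) → ∀ (L L' : Metric.sphere (0 : EuclideanSpace ℝ (Fin 2)) 1 → Base g) (hL : Continuous L) (hL' : Continuous L') (y y' : Metric.sphere (0 : EuclideanSpace ℝ (Fin 2)) 1 → bX.carrier) (a a' : Metric.sphere (0 : EuclideanSpace ℝ (Fin 2)) 1 → ↥(coresComplement h)), (∀ θ, L θ ∈ page g c₀) → (∀ θ, G₀ (bX.incl (y θ)) = D.jA (a θ)) → (∀ θ, ((a θ : ↥(coresComplement h)) : Base g) = L θ) → (∀ θ, (bBase g).incl (Ψ (y' θ)) = R.toFun T ((bBase g).incl (Ψ (y θ)))) → (∀ θ, G₀ (bX.incl (y' θ)) = D.jA (a' θ)) → (∀ θ, ((a' θ :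 ↥(coresComplement h)) : Base g) = L' θ) → shadow g L' hL' = shadow g L hL) :
    ∀ (g n : ℕ) (X₀ : Type) [TopologicalSpace X₀] [T2Space X₀] [SecondCountableTopology X₀]
      [CompactSpace X₀] [ChartedSpace (EuclideanHalfSpace 4) X₀] [IsManifold (𝓡∂ 4) ∞ X₀]
      (bX : BoundaryData (𝓡∂ 4) X₀ (𝓡 3)) (Ψ : bX.carrier ≃ₘ⟮𝓡 3, 𝓡 3⟯ (bBase g).carrier)
      (X : Type) [TopologicalSpace X] [T2Space X] [SecondCountableTopology X] [CompactSpace X]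
      [ChartedSpace (EuclideanHalfSpace 4) X] [IsManifold (𝓡∂ 4) ∞ X]
      (G₀ : X₀ ≃ₘ⟮𝓡∂ 4, 𝓡∂ 4⟯ X)
      (h : Fin n → HandleAttachingMap 3 2 (Base g)) (D : MultiAttachmentData h (𝓡∂ 4) X)
      (d : Fin n → ℂ) (v : Fin n → (Fin g ⊕ Fin g → ℤ)) (s : Fin n → Bool),
      (∀ k, ‖d k‖ = 1) →
      (∀ k θ, (h k).attachingCircle θ ∈ page g (d k)) →
      (∀ k, shadow g (h k).attachingCircle (h k).continuous_attachingCircle = v k) →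
      (∀ k, pageTwisting g (h k).attachingCircle (h k).attachingFraming = if s k then -1 else 1) →
      (∀ (y : bX.carrier) (a : ↥(coresComplement h)), G₀ (bX.incl y) = D.jA a →
        ∃ c : ℝ, 0 < c ∧ w g ((bBase g).incl (Ψ y)).1 = (c : ℂ) * w g (a : Base g).1) →
      (∀ (y : bX.carrier) (k : Fin n) (b : ↥(beltPiece 3 2)), G₀ (bX.incl y) = D.jB k b →
        G₀ (bX.incl y) ∉ range D.jA →
        ∃ c : ℝ, 0 < c ∧ w g ((bBase g).incl (Ψ y)).1 = (c : ℂ) * d k) →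
      ∀ (k₀ : Fin n) (φ : ℝ) (cross : Option (Fin n)), φ ≠ 0 → |φ| < 2 * π →
      (∀ k, k ≠ k₀ → cross ≠ some k → ∀ t ∈ Set.Icc (0 : ℝ) 1,
        d k ≠ d k₀ * Complex.exp (((t * φ : ℝ) : ℂ) * Complex.I)) →
      (∀ k₁, cross = some k₁ → k₁ ≠ k₀ ∧
        (∃ t ∈ Set.Ioo (0 : ℝ) 1, d k₁ = d k₀ * Complex.exp (((t * φ : ℝ) : ℂ) * Complex.I))) →
      ∃ (X' : Type) (_ : TopologicalSpace X') (_ : T2Space X') (_ : SecondCountableTopology X')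
        (_ : CompactSpace X') (_ : ChartedSpace (EuclideanHalfSpace 4) X')
        (_ : IsManifold (𝓡∂ 4) ∞ X') (h' : Fin n → HandleAttachingMap 3 2 (Base g))
        (D' : MultiAttachmentData h' (𝓡∂ 4) X') (G : X ≃ₘ⟮𝓡∂ 4, 𝓡∂ 4⟯ X'),
        (∀ k θ, (h' k).attachingCircle θ ∈
          page g (Function.update d k₀ (d k₀ * Complex.exp ((φ : ℂ) * Complex.I)) k)) ∧
        (∀ k, shadow g (h' k).attachingCircle (h' k).continuous_attachingCircle =
          Function.update v k₀ (Option.elim cross (v k₀)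
            (fun k₁ => transvection (stdSymp ℤ g) (v k₁, if 0 < φ then s k₁ else !s k₁) (v k₀))) k) ∧
        (∀ k, pageTwisting g (h' k).attachingCircle (h' k).attachingFraming = (if s k then -1 else 1)) ∧
        (∀ (y : bX.carrier) (a' : ↥(coresComplement h')), (G₀.trans G) (bX.incl y) = D'.jA a' →
          ∃ c : ℝ, 0 < c ∧ w g ((bBase g).incl (Ψ y)).1 = (c : ℂ) * w g (a' : Base g).1) ∧
        (∀ (y : bX.carrier) (k : Fin n) (b : ↥(beltPiece 3 2)), (G₀.trans G) (bX.incl y) = D'.jB k b →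
          (G₀.trans G) (bX.incl y) ∉ range D'.jA →
          ∃ c : ℝ, 0 < c ∧ w g ((bBase g).incl (Ψ y)).1 =
            (c : ℂ) * Function.update d k₀ (d k₀ * Complex.exp ((φ : ℂ) * Complex.I)) k) := by
  intro g n X₀ _ _ _ _ _ _ bX Ψ X _ _ _ _ _ _ G₀ h D d v s hd hpg hsh htw hseam hbelt k₀ φ cross hφ0 hφ
    hfree hcross
  obtain ⟨R, hRρ, hRw, hRflat, hRflow⟩ := exists_rigidRotation g
  -- shadows of equal loops (with different continuity proofs) agree
  have shc : ∀ {K K' : Metric.sphere (0 : EuclideanSpace ℝ (Fin 2)) 1 → Base g} (hK : Continuous K)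
      (hK' : Continuous K'), K = K' → shadow g K hK = shadow g K' hK' := by
    rintro K K' hK hK' rfl; rfl
  have hεn : ∀ ε : ℝ, ‖d k₀ * Complex.exp ((ε : ℂ) * Complex.I)‖ = 1 := fun ε => by
    rw [norm_mul, hd, Complex.norm_exp_ofReal_mul_I, mul_one]
  cases cross with
  | none =>
    have hfree' : ∀ k, k ≠ k₀ → ∀ t ∈ Set.Icc (0 : ℝ) 1,
        d k ≠ d k₀ * Complex.exp (((t * φ : ℝ) : ℂ) * Complex.I) :=
      fun k hk t ht => hfree k hk (by simp) t ht
    obtain ⟨X', i1, i2, i3, i4, i5, i6, h', D', G, R₁, R₃, τ₁, τ₃, ε, L, L', y, y', a, a', ⟨hε0, hε1⟩, hLc,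
      hL'c, hL, hLp, hy, ha, hrel, hy', ha', hcirc, hpg', hothers, htw', hO1, hO2⟩ :=
      HC1 g n X₀ bX Ψ X G₀ h D d hd hpg hseam hbelt k₀ φ R hφ0 hφ hRρ hRw hRflat hRflow hfree'
    -- the sub-arc `[ε, φ]` is free of directions
    have harc : ∀ k, ∀ t ∈ Set.Icc (0 : ℝ) 1, d k ≠ d k₀ * Complex.exp ((ε : ℂ) * Complex.I) *
        Complex.exp (((t * (φ - ε) : ℝ) : ℂ) * Complex.I) := by
      intro k t ht
      obtain ⟨⟨t'', ht'', he⟩, hne⟩ := subarc (d₀ := d k₀) hφ0 hφ hε0 hε1 ht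
      by_cases hk : k = k₀
      · subst hk; exact fun hh => hne (hd _) hh.symm
      · rw [he]; exact hfree' k hk t'' ht''
    have hshL' : shadow g L' hL'c = shadow g L hLc :=
      HE g n X₀ bX Ψ X G₀ h D d hd hseam hbelt R hRρ hRw (d k₀ * Complex.exp ((ε : ℂ) * Complex.I)) (φ - ε)
        (hεn ε) harc L L' hLc hL'c y y' a a' hLp hy ha hrel hy' ha'
    have hnew : shadow g (h' k₀).attachingCircle (h' k₀).continuous_attachingCircle = v k₀ := by
      have e1 : (h' k₀).attachingCircle = R₃.toFun τ₃ ∘ L' := funext hcirc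
      have e2 : L = R₁.toFun τ₁ ∘ (h k₀).attachingCircle := funext hL
      have c1 : Continuous (R₃.toFun τ₃ ∘ L') := (R₃.toDiffeomorph τ₃).continuous.comp hL'c
      have c2 : Continuous (R₁.toFun τ₁ ∘ (h k₀).attachingCircle) :=
        (R₁.toDiffeomorph τ₁).continuous.comp (h k₀).continuous_attachingCircle
      rw [shc _ c1 e1, shadow_comp_ambientIsotopy R₃ τ₃ hL'c c1, hshL', shc hLc c2 e2,
        shadow_comp_ambientIsotopy R₁ τ₁ (h k₀).continuous_attachingCircle c2, hsh k₀]
    refine ⟨X', i1, i2, i3, i4, i5, i6, h', D', G, ?_, ?_, ?_,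
      (clauses_of_dichotomy bX Ψ G₀ D d D' _ G hseam hbelt hO1 hO2).1,
      (clauses_of_dichotomy bX Ψ G₀ D d D' _ G hseam hbelt hO1 hO2).2⟩
    · intro k θ
      by_cases hk : k = k₀
      · subst hk; rw [Function.update_self]; exact hpg' θ
      · rw [Function.update_of_ne hk, (hothers k hk).1]; exact hpg k θ
    · intro k
      by_cases hk : k = k₀
      · subst hk; rw [Function.update_self, Option.elim_none]; exact hnew
      · rw [Function.update_of_ne hk, shc _ (h k).continuous_attachingCircle (hothers k hk).1]
        exact hsh k
    · intro k
      by_cases hk : k = k₀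
      · subst hk; rw [htw']; exact htw _
      · rw [(hothers k hk).1, (hothers k hk).2]; exact htw k
  | some k₁ =>
    obtain ⟨hk₁, t₁, ht₁, hdk₁⟩ := hcross k₁ rfl
    have hfree' : ∀ k, k ≠ k₀ → k ≠ k₁ → ∀ t ∈ Set.Icc (0 : ℝ) 1,
        d k ≠ d k₀ * Complex.exp (((t * φ : ℝ) : ℂ) * Complex.I) :=
      fun k hk hk1 t ht => hfree k hk (fun hh => hk1 (Option.some_injective _ hh).symm) t ht
    obtain ⟨X', i1, i2, i3, i4, i5, i6, h', D', G, R₁, R₃, τ₁, τ₃, ε, L, L', y, y', a, a', ⟨hε0, hε1⟩,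
      ⟨t₂, ht₂, hdk₂⟩, hLc, hL'c, hL, hLp, hy, ha, hrel, hy', ha', hcirc, hpg', hothers, htw', hO1, hO2⟩ :=
      HC2 g n X₀ bX Ψ X G₀ h D d hd hpg hseam hbelt k₀ k₁ φ R hk₁ hφ0 hφ hRρ hRw hRflat hRflow
        ⟨t₁, ht₁, hdk₁⟩ hfree'
    obtain ⟨hsign, hT0, hTabs⟩ := helper_sameSign_of_pushoff φ ε hε0 hε1
    have hT : |φ - ε| < 2 * π := hTabs.trans hφ
    -- the sub-arc `[ε, φ]` contains `d k₁` strictly and no other direction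
    have harc : ∀ k, k ≠ k₁ → ∀ t ∈ Set.Icc (0 : ℝ) 1, d k ≠ d k₀ * Complex.exp ((ε : ℂ) * Complex.I) *
        Complex.exp (((t * (φ - ε) : ℝ) : ℂ) * Complex.I) := by
      intro k hk1 t ht
      obtain ⟨⟨t'', ht'', he⟩, hne⟩ := subarc (d₀ := d k₀) hφ0 hφ hε0 hε1 ht
      by_cases hk : k = k₀
      · subst hk; exact fun hh => hne (hd _) hh.symm
      · rw [he]; exact hfree' k hk hk1 t'' ht''
    have hshL' : shadow g L' hL'c =
        transvection (stdSymp ℤ g) (v k₁, if 0 < φ - ε then s k₁ else !s k₁) (shadow g L hLc) :=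
      HD g n X₀ bX Ψ X G₀ h D d v s hd hpg hsh htw hseam hbelt k₁ R hRρ hRw hRflat hRflow
        (d k₀ * Complex.exp ((ε : ℂ) * Complex.I)) (φ - ε) (hεn ε) hT0 hT ⟨t₂, ht₂, hdk₂⟩ harc
        L L' hLc hL'c y y' a a' hLp hy ha hrel hy' ha'
    have hif : (if 0 < φ - ε then s k₁ else !s k₁) = (if 0 < φ then s k₁ else !s k₁) := by
      by_cases hp : 0 < φ
      · rw [if_pos hp, if_pos (hsign.2 hp)]
      · rw [if_neg hp, if_neg (fun hh => hp (hsign.1 hh))]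
    have hnew : shadow g (h' k₀).attachingCircle (h' k₀).continuous_attachingCircle =
        transvection (stdSymp ℤ g) (v k₁, if 0 < φ then s k₁ else !s k₁) (v k₀) := by
      have e1 : (h' k₀).attachingCircle = R₃.toFun τ₃ ∘ L' := funext hcirc
      have e2 : L = R₁.toFun τ₁ ∘ (h k₀).attachingCircle := funext hL
      have c1 : Continuous (R₃.toFun τ₃ ∘ L') := (R₃.toDiffeomorph τ₃).continuous.comp hL'c
      have c2 : Continuous (R₁.toFun τ₁ ∘ (h k₀).attachingCircle) :=
        (R₁.toDiffeomorph τ₁).continuous.comp (h k₀).continuous_attachingCircle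
      rw [shc _ c1 e1, shadow_comp_ambientIsotopy R₃ τ₃ hL'c c1, hshL', hif, shc hLc c2 e2,
        shadow_comp_ambientIsotopy R₁ τ₁ (h k₀).continuous_attachingCircle c2, hsh k₀]
    refine ⟨X', i1, i2, i3, i4, i5, i6, h', D', G, ?_, ?_, ?_,
      (clauses_of_dichotomy bX Ψ G₀ D d D' _ G hseam hbelt hO1 hO2).1,
      (clauses_of_dichotomy bX Ψ G₀ D d D' _ G hseam hbelt hO1 hO2).2⟩
    · intro k θ
      by_cases hk : k = k₀
      · subst hk; rw [Function.update_self]; exact hpg' θ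
      · rw [Function.update_of_ne hk, (hothers k hk).1]; exact hpg k θ
    · intro k
      by_cases hk : k = k₀
      · subst hk; rw [Function.update_self, Option.elim_some]; exact hnew
      · rw [Function.update_of_ne hk, shc _ (h k).continuous_attachingCircle (hothers k hk).1]
        exact hsh k
    · intro k
      by_cases hk : k = k₀
      · subst hk; rw [htw']; exact htw _
      · rw [(hothers k hk).1, (hothers k hk).2]; exact htw k

end Summit.SmoothPoincare4.SmoothPoincare4.Theorems.AcyclicBisectionExists.ModpBraidOrbits

end
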